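import Literature.Computability.Cryptography.QubitRegister
import HarnessLib

/-!
# The Pauli `Z` gate is unitary — discharge of `pauliZ_mem_unitaryGroup`

Proof of the named fact `Literature.Computability.Cryptography.pauliZ_mem_unitaryGroup` stated in
`Literature.Computability.Cryptography.QubitRegister`. It is kept in its own sibling file (like
the discharges of the `H`, `T`, `CZ` and Toffoli facts): the shared `QubitRegisterProofs.lean` is
replaced whole by concurrent discharges of the other named-gate facts, and one file per discharge
cannot be lost to such an overwrite.

* `pauliZ_eq_diagonal`: the matrix `pauliZ : Matrix (QReg 1) (QReg 1) ℂ` is the diagonal matrix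
  with entry `-1` on the label with bit `true` (`|1⟩`) and `1` on the label with bit `false`
  (`|0⟩`), i.e. `Z = diag(1, -1)` (Nielsen–Chuang, §2.1.3, Fig. 2.2, book p. 65);
* `pauliZ_mem_unitaryGroup_holds` discharges `pauliZ_mem_unitaryGroup`: `Z Z† = diag(d · conj d) = 1`
  since both diagonal entries `d ∈ {1, -1}` satisfy `d · conj d = 1`. This is the `Z` case of
  Nielsen–Chuang, Exercise 2.19 (§2.1.6, book p. 71): "the Pauli matrices are Hermitian and
  unitary". (The fact's own docstring points to §2.1.5; in the 2010 edition the unitarity of the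
  Pauli matrices is Exercise 2.19 of §2.1.6 — the statement is the same.)

## References

* M. A. Nielsen, I. L. Chuang, *Quantum Computation and Quantum Information*, 10th anniversary
  ed., Cambridge University Press 2010, doi:10.1017/cbo9780511976667: §2.1.3, Fig. 2.2, p. 65
  (the Pauli matrices, `Z = [[1, 0], [0, -1]]`); §2.1.6, Exercise 2.19, p. 71 (the Pauli matrices
  are Hermitian and unitary). [cite: NielsenChuang2010, §2.1.6 Exercise 2.19, p. 71]
-/

namespace Literature.Computability.Cryptography

open Matrix

/-- The Pauli `Z` gate is the diagonal matrix `diag(1, -1)` in the computational basis: entry `-1`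
on the label with bit `true`, entry `1` on the label with bit `false` (definitional unfolding of
`pauliZ`). [Nielsen–Chuang 2010, §2.1.3 Fig. 2.2, p. 65] [cite: NielsenChuang2010, §2.1.3 Fig. 2.2, p. 65] -/
theorem pauliZ_eq_diagonal :
    pauliZ = Matrix.diagonal fun x : QReg 1 => if x 0 = true then (-1 : ℂ) else 1 := by
  ext x y
  rw [pauliZ, Matrix.of_apply, Matrix.diagonal_apply]

/-- **Discharge of `pauliZ_mem_unitaryGroup`.** The Pauli `Z` gate is unitary: `Z = diag(1, -1)`
(Nielsen–Chuang, §2.1.3, Fig. 2.2, p. 65) has `Z† = diag(conj 1, conj (-1)) = Z` and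
`Z Z† = diag(1 · conj 1, (-1) · conj (-1)) = diag(1, 1) = 1`, i.e. `Z ∈ U(QReg 1)`. This is the
`Z` case of Nielsen–Chuang, Exercise 2.19 (§2.1.6, p. 71: "the Pauli matrices are Hermitian and
unitary"). [cite: NielsenChuang2010, §2.1.6 Exercise 2.19, p. 71] -/
theorem pauliZ_mem_unitaryGroup_holds : pauliZ_mem_unitaryGroup := by
  unfold pauliZ_mem_unitaryGroup
  rw [Matrix.mem_unitaryGroup_iff, pauliZ_eq_diagonal, star_eq_conjTranspose,
    diagonal_conjTranspose, diagonal_mul_diagonal, ← diagonal_one]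
  congr 1
  funext x
  by_cases hx : x 0 = true <;> simp [hx]

end Literature.Computability.Cryptography
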